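import Summits.ABC.IUTFork.Thm311ToCor312
import HarnessLib

/-!
# [IUTchIII] Corollary 3.12 over the typed setting — the (Ind2)-SLOT images of the Θ-pilot region, their holomorphic hull, and
# the per-image («reading (P)») form of the Step (xi-f) licence

Record file (D-0012) of the abc-iut cell (branch C certificate seat abc-iut-C-cert-2 gen 3; TYPING GAP named by abc-iut-c312-1 gen 8,
2026-08-26T16:47:09Z, in answer to question (a) of the γ design note of C-lead ruling C-R35 (3)(γ) / C-R38: «neither
`Cor312.Setting` nor `Real.settingPrVolSharp` EXPOSES an (Ind1)-free per-(j,v_ℚ) SLOT hull; it is a GAP of exactly ONE reviewed def»;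
the shape below is abc-iut-c312-1's, by name). TAKES NO SIDE on [IUTchIII] Cor. 3.12, on the reading (U)/(P) of `−|log(Θ)|`, or on
any author; DEFINITIONS over the typed setting only — nothing is asserted.

S. Mochizuki, *Inter-universal Teichmüller theory III* [Mochizuki2012] (kurims manuscript): Thm. 3.11 (i) p. 154 «(Ind2) for each
`v_ℚ ∈ 𝕍_ℚ^non` … the indeterminacies induced by the action of independent copies of Ism … on each of the direct summands of the `j+1`
factors»; Cor. 3.12 p. 173 l. 49 – p. 174 l. 3 «the holomorphic hull … of the union of the possible images of a Θ-pilot object …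
subject to the indeterminacies (Ind1), (Ind2), (Ind3)»; proof Step (x) p. 181 (the per-image computation of the log-volume). T. Dupuy,
A. Hilado [DupuyHilado2025] §4.11 (`U_Θ^slot`: the (Ind2)-orbit of the Θ-region, slot by slot), §4.12 (its hull and log-volume). The
cell's typed Cor. 3.12 setting (abc-iut-c312-7, `Cor312Statement.lean`, FROZEN) forms `Setting.possibleImages j v_ℚ` = the translates of
the (Ind3)-enlarged Θ-region `thetaRegion3 j v_ℚ` by the group GENERATED by the (Ind1)-families AND the (Ind2)-families
(`Cor312.indGroup`), and `thetaHull` = the hull of their union — READING (U). The Literature-level Dupuy–Hilado twin of the present file is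
abc-iut-c312-3 / S2's `PrimePacket.slotImages` / `slotImagesHull` (`GenuineLogThetaPerImage.lean`, reading (P)). THIS FILE adds, over the
SAME frozen setting and WITHOUT editing it (new declarations only):

* `Setting.thetaSlotImages P j v_ℚ` — the translates of `thetaRegion3 j v_ℚ` by the (Ind2)-FAMILIES ONLY (`S.L.Ind2Family`,
  abc-iut-c312-1 `Thm311Multirad`: at each `(j, v_ℚ)` an element of `LogShells.Ind2 j v_ℚ` — independent `Ism`-elements on each summand
  of each factor; NO capsule permutation, NO strip automorphism);
* `Setting.thetaSlotHull P j v_ℚ` — the holomorphic hull (the setting's frame) of their union: the (Ind1)-FREE hull;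
* `Setting.SlotLicence P` — the Step (xi-f) inclusion read PER SLOT-HULL: at every label `j ∈ 𝔽_l^⋇` and every `v_ℚ`, the q-pilot
  region lies in `thetaSlotHull` (STRONGER than the cell's (U)-licence `Thm311ToCor312.Licence`, which asks only for the hull of the
  union of ALL possible images);
* the reading-(P) twins `Setting.SlotHullDefined` / `thetaSlotLocal` / `ThetaSlotFinite` / `negLogThetaSlot` / `SlotStatement` of the
  frozen `HullDefined` / `thetaLocal` / `ThetaFinite` / `negLogTheta` / `Statement` (same shapes, `thetaSlotHull` for `thetaHull`);
and proves the bookkeeping: `thetaSlotImages ⊆ possibleImages` (`ind2Family` lies in the generated group), `thetaRegion3 ∈ thetaSlotImages`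
(the identity family is an (Ind2)-family), `thetaSlotHull ⊆ thetaHull` (hull monotonicity), `thetaRegion3 ⊆ thetaSlotHull`, and
**`licence_of_slotLicence : SlotLicence P → Thm311ToCor312.Licence P`** («(P) implies (U)» at the region level), and
**`slotStatement_of_slotLicence`** (slot licence + monotone log-volume + `ThetaSlotFinite` ⟹ `SlotStatement`; the (P) twin of abc-iut-c312-6's
`Cor312Vol.statement_of_qRegion_subset_thetaHull`).

USE (branch C, γ line): the per-image certificate «abc ⇐ [¬ SlotLicence(T) → T.Cor312PerImageOf at Szpiro-bad admissible data]» needs the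
per-image Θ-side READ at the sharp K-setting (abc-iut-s2-p7 «HΘP-K», in flight) and consumes `SlotLicence` as its S-side clause.
HONEST SCOPE: a statement about OUR typed objects; `SlotLicence` is a STRONGER-THAN-PRINT reading of Step (xi-f) (print: hull of the union
of all possible images, p. 184 l. 26–29); nothing here asserts that any licence holds at any datum. [claim: Mochizuki2012, status: disputed]
[cite: Mochizuki2012, IUTchIII Thm. 3.11 (i) p. 154; Cor. 3.12 p. 173–174, Step (x) p. 181, Step (xi-f) p. 184; Rmk. 3.9.5 (i) p. 127]
[cite: DupuyHilado2025, §4.11–4.12]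
-/

noncomputable section

namespace Summit.ABC.IUTFork.Cor312.Setting

open Thm311 Literature.IUT.LogThetaLattice

variable {T : ThetaIndex} {S : Situation T} (P : Setting S)

/-- **The (Ind2)-slot images of the Θ-pilot region at `(j, v_ℚ)`**: the translates of the (Ind3)-enlarged region `thetaRegion3 j v_ℚ`
by the (Ind2)-families `Φ ∈ S.L.Ind2Family` (independent `Ism`-elements on each direct summand of each tensor factor — [IUTchIII]
Thm. 3.11 (i) (Ind2); NO capsule permutation and NO strip automorphism, i.e. none of (Ind1)). Dupuy–Hilado's `U_Θ^slot` at the level of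
the typed setting. [cite: Mochizuki2012, IUTchIII Thm. 3.11 (i) p. 154] [cite: DupuyHilado2025, §4.11] [claim: Mochizuki2012, status: disputed] -/
def thetaSlotImages (j : T.Label) (vQ : T.VQ) : Set (Set (S.L.Packet j vQ)) :=
  {U | ∃ Φ ∈ S.L.Ind2Family, U = Φ j vQ '' P.thetaRegion3 j vQ}

/-- **The slot hull at `(j, v_ℚ)`**: the holomorphic hull (in the setting's frame, [IUTchIII] Rmk. 3.9.5 (i)) of the union of the
(Ind2)-slot images — the (Ind1)-FREE analogue of `thetaHull`. [cite: Mochizuki2012, IUTchIII Rmk. 3.9.5 (i) p. 127]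
[cite: DupuyHilado2025, §4.12] [claim: Mochizuki2012, status: disputed] -/
def thetaSlotHull (j : T.Label) (vQ : T.VQ) : Set (S.L.Packet j vQ) :=
  (P.frame j vQ).hull (⋃₀ P.thetaSlotImages j vQ)

/-- Every (Ind2)-slot image is a possible image (an (Ind2)-family lies in the group generated by (Ind1) ∪ (Ind2)). [folklore] -/
theorem thetaSlotImages_subset_possibleImages (j : T.Label) (vQ : T.VQ) :
    P.thetaSlotImages j vQ ⊆ P.possibleImages j vQ := by
  rintro U ⟨Φ, hΦ, rfl⟩
  exact ⟨Φ, Subgroup.subset_closure (Set.mem_union_right _ hΦ), rfl⟩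

/-- The identity family is an (Ind2)-family (the trivial `Ism`-element on every summand). [folklore] -/
theorem one_mem_ind2Family : (1 : S.L.PacketAut) ∈ S.L.Ind2Family :=
  fun j vQ => S.L.refl_mem_Ind2 j vQ

/-- The Θ-region itself is one of its slot images (identity of (Ind2)). [folklore] -/
theorem thetaRegion3_mem_thetaSlotImages (j : T.Label) (vQ : T.VQ) :
    P.thetaRegion3 j vQ ∈ P.thetaSlotImages j vQ :=
  ⟨1, one_mem_ind2Family, by simp⟩

/-- The slot images are indexed by (Ind2)-FAMILIES; a single slot automorphism `φ ∈ LogShells.Ind2 j v_ℚ` (abc-iut-c312-1's local shape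
`⋃ φ ∈ S.L.Ind2 j vQ, φ '' thetaRegion3`) gives one too — extend `φ` by the identity at every other `(j', v_ℚ')` (the identity is an
(Ind2)-element everywhere, `LogShells.refl_mem_Ind2`). [folklore] -/
theorem image_mem_thetaSlotImages_of_mem_Ind2 {j : T.Label} {vQ : T.VQ} {φ : S.L.Packet j vQ ≃ₗ[ℚ] S.L.Packet j vQ}
    (hφ : φ ∈ S.L.Ind2 j vQ) : φ '' P.thetaRegion3 j vQ ∈ P.thetaSlotImages j vQ := by
  classical
  refine ⟨Function.update (1 : S.L.PacketAut) j (Function.update ((1 : S.L.PacketAut) j) vQ φ), ?_, ?_⟩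
  · intro j' vQ'
    by_cases hj : j' = j
    · subst hj
      rw [Function.update_self]
      by_cases hv : vQ' = vQ
      · subst hv; rw [Function.update_self]; exact hφ
      · rw [Function.update_of_ne hv]; exact S.L.refl_mem_Ind2 _ vQ'
    · rw [Function.update_of_ne hj]; exact S.L.refl_mem_Ind2 j' vQ'
  · rw [Function.update_self, Function.update_self]

/-- The union of the slot images lies in the union of all possible images. [folklore] -/
theorem sUnion_thetaSlotImages_subset (j : T.Label) (vQ : T.VQ) :
    ⋃₀ P.thetaSlotImages j vQ ⊆ ⋃₀ P.possibleImages j vQ :=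
  Set.sUnion_subset_sUnion (P.thetaSlotImages_subset_possibleImages j vQ)

/-- **`thetaSlotHull ⊆ thetaHull`**: the (Ind1)-free hull lies in the hull of the union of all possible images (hull monotonicity,
[IUTchIII] Rmk. 3.9.5 (ii) (P3)). [cite: Mochizuki2012, IUTchIII Rmk. 3.9.5 (ii) p. 127] [claim: Mochizuki2012, status: disputed] -/
theorem thetaSlotHull_subset_thetaHull (j : T.Label) (vQ : T.VQ) :
    P.thetaSlotHull j vQ ⊆ P.thetaHull j vQ :=
  (P.frame j vQ).hull_mono (P.sUnion_thetaSlotImages_subset j vQ)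

/-- The Θ-region lies in its slot hull. [folklore] -/
theorem thetaRegion3_subset_thetaSlotHull (j : T.Label) (vQ : T.VQ) :
    P.thetaRegion3 j vQ ⊆ P.thetaSlotHull j vQ :=
  (Set.subset_sUnion_of_mem (P.thetaRegion3_mem_thetaSlotImages j vQ)).trans ((P.frame j vQ).subset_hull _)

/-- **The Step (xi-f) licence READ PER SLOT HULL** («reading (P)» at the region level): at every label `j ∈ 𝔽_l^⋇` and every place
`v_ℚ`, the image of the q-pilot object lies in the holomorphic hull of the union of the (Ind2)-SLOT images of the Θ-pilot object.
HYPOTHESIS form — a `Prop` over the setting, never asserted; STRONGER than the cell's (U)-licence `Thm311ToCor312.Licence` (hull of the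
union of ALL possible images, [IUTchIII] Step (xi-f) p. 184 l. 26–29). [cite: Mochizuki2012, IUTchIII Cor. 3.12 Step (xi-f) p. 184,
Step (x) p. 181] [cite: DupuyHilado2025, §4.12] [claim: Mochizuki2012, status: disputed] -/
@[claim "Mochizuki2012" "disputed"] def SlotLicence : Prop :=
  ∀ (i : Fin T.lstar) (vQ : T.VQ), P.qRegion (labelSucc i) vQ ⊆ P.thetaSlotHull (labelSucc i) vQ

/-- **(P) ⟹ (U) at the region level**: the slot licence implies the cell's (xi-f) licence `Thm311ToCor312.Licence` (the slot hull
lies in the full hull). [cite: Mochizuki2012, IUTchIII Cor. 3.12 Step (xi-f) p. 184] [claim: Mochizuki2012, status: disputed] -/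
theorem licence_of_slotLicence (h : P.SlotLicence) : Thm311ToCor312.Licence P :=
  fun i vQ => (h i vQ).trans (P.thetaSlotHull_subset_thetaHull _ vQ)

/-! ## The per-slot-hull («reading (P)») twins of the setting's printed quantities — same shapes as the frozen `HullDefined` /
`thetaLocal` / `ThetaFinite` / `negLogTheta` / `Statement` of `Cor312Statement.lean`, with `thetaSlotHull` in place of `thetaHull` -/

/-- The union of the slot images at `(j, v_ℚ)` admits its holomorphic hull (relatively compact and non-degenerate) — the slot twin of
`HullDefined`. [cite: Mochizuki2012, IUTchIII Rmk. 3.9.5 (i) p. 127] [claim: Mochizuki2012, status: disputed] -/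
def SlotHullDefined (j : T.Label) (vQ : T.VQ) : Prop :=
  (P.frame j vQ).IsBounded (⋃₀ P.thetaSlotImages j vQ) ∧ (P.frame j vQ).HasHull (⋃₀ P.thetaSlotImages j vQ)

/-- The slot union is relatively compact as soon as the full union is (it is smaller). [folklore] -/
theorem isBounded_sUnion_thetaSlotImages_of_hullDefined {j : T.Label} {vQ : T.VQ} (h : P.HullDefined j vQ) :
    (P.frame j vQ).IsBounded (⋃₀ P.thetaSlotImages j vQ) :=
  (P.frame j vQ).bounded_mono _ _ (P.sUnion_thetaSlotImages_subset j vQ) h.1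

/-- Under `SlotHullDefined` the slot hull is a hull-set, hence an admissible region of Thm. 3.11 (i) (a). [folklore] -/
theorem thetaSlotHull_adm {j : T.Label} {vQ : T.VQ} (h : P.SlotHullDefined j vQ) :
    (S.D P.n).Adm j vQ (P.thetaSlotHull j vQ) :=
  P.hul_adm j vQ _ ((P.frame j vQ).hull_mem_of_hasHull h.1 h.2)

open scoped Classical in
/-- The local contribution at `(j, v_ℚ)` to `−|log(Θ)|` IN READING (P): the mono-analytic log-volume of the slot hull when it is defined,
`+∞` otherwise — the slot twin of `thetaLocal`. [cite: Mochizuki2012, IUTchIII Cor. 3.12 proof Step (x) p. 181]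
[claim: Mochizuki2012, status: disputed] -/
def thetaSlotLocal (j : T.Label) (vQ : T.VQ) : WithTop ℝ :=
  if P.SlotHullDefined j vQ then (((S.D P.n).logvol j vQ (P.thetaSlotHull j vQ) : ℝ) : WithTop ℝ) else ⊤

/-- «`−|log(Θ)|` is finite» IN READING (P): every slot hull at a label in `𝔽_l^⋇` is defined and the local terms vanish at all but
finitely many `v_ℚ` — the slot twin of `ThetaFinite`. [claim: Mochizuki2012, status: disputed] -/
@[claim "Mochizuki2012" "disputed"] def ThetaSlotFinite : Prop :=
  (∀ (i : Fin T.lstar) (vQ : T.VQ), P.thetaSlotLocal (labelSucc i) vQ ≠ ⊤) ∧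
    ∀ i : Fin T.lstar, (Function.support fun vQ => (P.thetaSlotLocal (labelSucc i) vQ).untopD 0).Finite

open scoped Classical in
/-- **`−|log(Θ)|` IN READING (P)** over the typed setting: the procession-normalised global sum of the slot-hull log-volumes
(`⊤ = +∞` unless `ThetaSlotFinite`) — the slot twin of `negLogTheta`; Dupuy–Hilado's per-slot-image number at the level of the setting.
[cite: Mochizuki2012, IUTchIII Cor. 3.12 p. 173 l. 43 – p. 174 l. 3, proof Step (x) p. 181] [cite: DupuyHilado2025, §4.12]
[claim: Mochizuki2012, status: disputed] -/
def negLogThetaSlot : WithTop ℝ :=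
  if P.ThetaSlotFinite then
    ((processionNormalized fun i : Fin T.lstar =>
        ∑ᶠ vQ : T.VQ, (P.thetaSlotLocal (labelSucc i) vQ).untopD 0 : ℝ) : WithTop ℝ)
  else ⊤

/-- **[IUTchIII] Cor. 3.12's conclusion IN READING (P) over the typed setting**: «`−|log(Θ)|_(P) ∈ ℝ` and `−|log(Θ)|_(P) ≥ −|log(q)|`» with
the SLOT-hull volume — the slot twin of `Statement`. A `Prop`, never asserted; STRONGER than `Statement` whenever the slot-hull volume is at
most the full-hull volume. [cite: Mochizuki2012, IUTchIII Cor. 3.12 p. 174 l. 16–18, Step (x) p. 181] [claim: Mochizuki2012, status: disputed] -/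
@[claim "Mochizuki2012" "disputed"] def SlotStatement : Prop :=
  P.negLogThetaSlot ≠ ⊤ ∧ ((P.negLogQ : ℝ) : WithTop ℝ) ≤ P.negLogThetaSlot

/-- Under `ThetaSlotFinite`, every slot hull at a label in `𝔽_l^⋇` is defined. [folklore] -/
theorem slotHullDefined_of_finite (h : P.ThetaSlotFinite) (i : Fin T.lstar) (vQ : T.VQ) :
    P.SlotHullDefined (labelSucc i) vQ := by
  by_contra hb
  exact h.1 i vQ (by unfold thetaSlotLocal; rw [if_neg hb])

/-- Under `ThetaSlotFinite`, the local slot term is the real log-volume of the slot hull. [folklore] -/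
theorem thetaSlotLocal_untopD (h : P.ThetaSlotFinite) (i : Fin T.lstar) (vQ : T.VQ) :
    (P.thetaSlotLocal (labelSucc i) vQ).untopD 0 = (S.D P.n).logvol _ vQ (P.thetaSlotHull (labelSucc i) vQ) := by
  unfold thetaSlotLocal
  rw [if_pos (P.slotHullDefined_of_finite h i vQ)]
  rfl

/-- **The slot licence implies the reading-(P) statement** (monotonicity of the log-volume, [IUTchIII] Prop. 3.9 (ii)): if the q-pilot
region lies in the slot hull in every packet at the labels `𝔽_l^⋇`, the log-volume is monotone on admissible regions there, and
`−|log(Θ)|_(P)` is finite, then `−|log(q)| ≤ −|log(Θ)|_(P)`. The (P) twin of abc-iut-c312-6's `Cor312Vol.statement_of_qRegion_subset_thetaHull`.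
Nothing asserted about the hypotheses. [cite: Mochizuki2012, IUTchIII Prop. 3.9 (ii) p. 126; Cor. 3.12 Step (xi-f) p. 184]
[claim: Mochizuki2012, status: disputed] -/
theorem slotStatement_of_slotLicence
    (hmono : ∀ (i : Fin T.lstar) (vQ : T.VQ) ⦃A B : Set (S.L.Packet (labelSucc i) vQ)⦄,
      (S.D P.n).Adm _ vQ A → (S.D P.n).Adm _ vQ B → A ⊆ B → (S.D P.n).logvol _ vQ A ≤ (S.D P.n).logvol _ vQ B)
    (hfin : P.ThetaSlotFinite) (h : P.SlotLicence) : P.SlotStatement := by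
  have hne : P.negLogThetaSlot ≠ ⊤ := by unfold negLogThetaSlot; rw [if_pos hfin]; exact WithTop.coe_ne_top
  refine ⟨hne, ?_⟩
  unfold negLogThetaSlot
  rw [if_pos hfin, WithTop.coe_le_coe]
  unfold negLogQ processionNormalized
  refine div_le_div_of_nonneg_right (Finset.sum_le_sum fun i _ => ?_) (Nat.cast_nonneg _)
  refine finsum_le_finsum' (P.qSupport_finite _) (hfin.2 i) fun vQ => ?_
  rw [P.thetaSlotLocal_untopD hfin i vQ]
  exact hmono i vQ (P.hul_adm _ vQ _ (P.qRegion_mem _ vQ)) (P.thetaSlotHull_adm (P.slotHullDefined_of_finite hfin i vQ)) (h i vQ)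

end Summit.ABC.IUTFork.Cor312.Setting

end
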